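import Mathlib
import Summits.NavierStokesRegularity.NavierStokesRegularity.Theorems.EulerZoomLiouvillePowerGaugeEulerLiouvilleSelfSimilarKelvinFlowC2

/-!
# Crux `EulerZoomLiouville.PowerGaugeEulerLiouville` (stmt-NavierStokesRegularity-19832), THE ONE STATEMENT `stub_selfSimilarC2Needle`:
# EXITS PASS THROUGH THE ANOMALOUS SET — a backward similarity orbit reaches the sphere `‖y‖ = t` for the first time only at a point where `⟪y, V y⟫ ≤ −γt²`

ROUND-42 (nsreg-p2 g33) «THE CONDENSER», step (B1).  Backward similarity flow `Ψ_σ y = Φ_{−σ} y` of `W = γy + V` (`Ψ' = −W(Ψ)`), `V ∈ C¹` with bounded derivative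
(the global cut-off flow of THE ONE STATEMENT; tree `C2.Kelvin.hasDerivAt_flow_neg`).  Pure ODE kinematics, no Euler equation:
* `hasDerivAt_norm_flow_neg_sq` — `d/dσ ‖Ψ_σ y‖² = −2⟪Ψ_σ y, W(Ψ_σ y)⟫`;
* `inner_transport_nonpos_of_firstHit` — if `‖Ψ_σ y‖ < t` on `[0, σ₁)` and `‖Ψ_{σ₁} y‖ = t` (`σ₁ > 0`) then `⟪Ψ_{σ₁} y, W(Ψ_{σ₁} y)⟫ ≤ 0` (left difference quotients
  of `‖Ψ‖²` at a first hitting time are `≥ 0`);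
* `inner_le_neg_mul_sq_of_firstHit`, `mul_le_norm_of_firstHit` — hence `⟪y₁, V y₁⟫ ≤ −γt²` and `γt ≤ ‖V y₁‖` at `y₁ = Ψ_{σ₁} y`: THE EXIT POINT IS ANOMALOUS
  (`|V| ≥ γ|y|`, radial inflow at least the similarity drift);
* `exists_firstHit_of_exit` — an orbit with `‖y‖ < t ≤ ‖Ψ_L y‖` has a first hitting time `σ₁ ∈ (0, L]` of the sphere `‖·‖ = t`;
* `exists_anomalous_of_exit` — so every backward orbit leaving `B(0,t)` produces a point `y₁`, `‖y₁‖ = t`, with `⟪y₁, V y₁⟫ ≤ −γt²` and `‖V y₁‖ ≥ γt`.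
With the profile-level gauges (`∫_{B_R}|V|² ≲ R^{1−2ρ}`: such points are rare on most spheres; `∫_{B_R}|DV|² ≲ R^{1−ρ}`) the 2-D condenser on quiet spheres turns this into
THEOREM B of ROUND-42 (TEXT): leaving `B(0,2R)` from `B(0,R)` costs `sup_{[R,2R]}‖DV‖ ≥ c₁R^{2+ρ}e^{c₂R^{2+ρ}}`.

WHAT THIS IS NOT: not NS, not E — kinematics for THE ONE STATEMENT; 19832 is OPEN.  [folklore]
-/

noncomputable section

set_option linter.dupNamespace false

open Set Metric Filter Topology Function InnerProductSpace
open scoped RealInnerProductSpace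

namespace Summit.NavierStokesRegularity.NavierStokesRegularity.Theorems.PowerGaugeEulerLiouville.Condenser

open Literature.Analysis Literature.Analysis.FluidPDE
open Summit.NavierStokesRegularity.NavierStokesRegularity.Theorems.PowerGaugeEulerLiouville.C2

variable {γ : ℝ} {V : (EuclideanSpace ℝ (Fin 3)) → (EuclideanSpace ℝ (Fin 3))}

/-- `d/dσ ‖Ψ_σ y‖² = −2⟪Ψ_σ y, W(Ψ_σ y)⟫` along the backward similarity flow. [folklore] -/
theorem hasDerivAt_norm_flow_neg_sq (hV : ContDiff ℝ 1 V) {K : ℝ} (hK : ∀ y, ‖fderiv ℝ V y‖ ≤ K)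
    (y : EuclideanSpace ℝ (Fin 3)) (r : ℝ) :
    HasDerivAt (fun s => ‖ODE.evolutionMap (fun _ : ℝ => selfSimilarTransport γ 0 V) 0 (-s) y‖ ^ 2)
      (-(2 * ⟪ODE.evolutionMap (fun _ : ℝ => selfSimilarTransport γ 0 V) 0 (-r) y,
        selfSimilarTransport γ 0 V (ODE.evolutionMap (fun _ : ℝ => selfSimilarTransport γ 0 V) 0 (-r) y)⟫)) r := by
  have h := (Kelvin.hasDerivAt_flow_neg (γ := γ) hV hK y r).norm_sq
  simp only [inner_smul_right, neg_mul, one_mul, mul_neg] at h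
  exact h

/-- **First hitting ⇒ outward.**  If `‖Ψ_σ y‖ < t` for `σ ∈ [0, σ₁)` and `‖Ψ_{σ₁} y‖ = t` with `σ₁ > 0`, then `⟪Ψ_{σ₁} y, W(Ψ_{σ₁} y)⟫ ≤ 0`
(the left difference quotients of `‖Ψ_σ y‖²` at `σ₁` are non-negative). [folklore] -/
theorem inner_transport_nonpos_of_firstHit (hV : ContDiff ℝ 1 V) {K : ℝ} (hK : ∀ y, ‖fderiv ℝ V y‖ ≤ K)
    {y : EuclideanSpace ℝ (Fin 3)} {t σ₁ : ℝ} (hσ₁ : 0 < σ₁)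
    (hlt : ∀ σ ∈ Ico (0 : ℝ) σ₁, ‖ODE.evolutionMap (fun _ : ℝ => selfSimilarTransport γ 0 V) 0 (-σ) y‖ < t)
    (heq : ‖ODE.evolutionMap (fun _ : ℝ => selfSimilarTransport γ 0 V) 0 (-σ₁) y‖ = t) :
    ⟪ODE.evolutionMap (fun _ : ℝ => selfSimilarTransport γ 0 V) 0 (-σ₁) y,
      selfSimilarTransport γ 0 V (ODE.evolutionMap (fun _ : ℝ => selfSimilarTransport γ 0 V) 0 (-σ₁) y)⟫ ≤ 0 := by
  set g : ℝ → ℝ := fun s => ‖ODE.evolutionMap (fun _ : ℝ => selfSimilarTransport γ 0 V) 0 (-s) y‖ ^ 2 with hg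
  set I : ℝ := ⟪ODE.evolutionMap (fun _ : ℝ => selfSimilarTransport γ 0 V) 0 (-σ₁) y,
      selfSimilarTransport γ 0 V (ODE.evolutionMap (fun _ : ℝ => selfSimilarTransport γ 0 V) 0 (-σ₁) y)⟫ with hI
  have hder : HasDerivAt g (-(2 * I)) σ₁ := hasDerivAt_norm_flow_neg_sq hV hK y σ₁
  -- the derivative is the limit of the slopes from the left
  have hwithin : HasDerivWithinAt g (-(2 * I)) (Iio σ₁) σ₁ := hder.hasDerivWithinAt
  have hset : Iio σ₁ \ {σ₁} = Iio σ₁ := by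
    ext x
    simp only [Set.mem_sdiff, mem_Iio, mem_singleton_iff]
    exact ⟨fun h => h.1, fun h => ⟨h, h.ne⟩⟩
  rw [hasDerivWithinAt_iff_tendsto_slope, hset] at hwithin
  -- slopes from the left (within `(0, σ₁)`) are non-negative
  have hev : ∀ᶠ s in 𝓝[Iio σ₁] σ₁, 0 ≤ slope g σ₁ s := by
    filter_upwards [Ioo_mem_nhdsLT hσ₁] with s hs
    rw [slope_def_field]
    have hgs : g s < g σ₁ := by
      simp only [hg, heq]
      have h1 := hlt s ⟨hs.1.le, hs.2⟩
      have h0 : 0 ≤ ‖ODE.evolutionMap (fun _ : ℝ => selfSimilarTransport γ 0 V) 0 (-s) y‖ := norm_nonneg _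
      nlinarith
    have hden : s - σ₁ < 0 := by linarith [hs.2]
    exact (div_pos_of_neg_of_neg (by linarith) hden).le
  have h0 : 0 ≤ -(2 * I) := ge_of_tendsto hwithin hev
  linarith

/-- **THE EXIT POINT IS ANOMALOUS (radial form).**  At a first hitting point `y₁ = Ψ_{σ₁} y` of the sphere `‖·‖ = t`:  `⟪y₁, V y₁⟫ ≤ −γ t²`. [folklore] -/
theorem inner_le_neg_mul_sq_of_firstHit (hV : ContDiff ℝ 1 V) {K : ℝ} (hK : ∀ y, ‖fderiv ℝ V y‖ ≤ K)
    {y : EuclideanSpace ℝ (Fin 3)} {t σ₁ : ℝ} (hσ₁ : 0 < σ₁)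
    (hlt : ∀ σ ∈ Ico (0 : ℝ) σ₁, ‖ODE.evolutionMap (fun _ : ℝ => selfSimilarTransport γ 0 V) 0 (-σ) y‖ < t)
    (heq : ‖ODE.evolutionMap (fun _ : ℝ => selfSimilarTransport γ 0 V) 0 (-σ₁) y‖ = t) :
    ⟪ODE.evolutionMap (fun _ : ℝ => selfSimilarTransport γ 0 V) 0 (-σ₁) y,
      V (ODE.evolutionMap (fun _ : ℝ => selfSimilarTransport γ 0 V) 0 (-σ₁) y)⟫ ≤ -(γ * t ^ 2) := by
  have h := inner_transport_nonpos_of_firstHit hV hK hσ₁ hlt heq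
  rw [selfSimilarTransport_apply, sub_zero, inner_add_right, real_inner_smul_right, real_inner_self_eq_norm_sq,
    heq] at h
  linarith

/-- **THE EXIT POINT IS ANOMALOUS (size form).**  At a first hitting point `y₁` of the sphere `‖·‖ = t > 0`:  `γ t ≤ ‖V y₁‖` — the profile velocity is at least
the similarity drift there (for the class, such points have area `O(R^{−2−2ρ})` on most spheres of radius `t ∈ [R,2R]`). [folklore] -/
theorem mul_le_norm_of_firstHit (hV : ContDiff ℝ 1 V) {K : ℝ} (hK : ∀ y, ‖fderiv ℝ V y‖ ≤ K)
    {y : EuclideanSpace ℝ (Fin 3)} {t σ₁ : ℝ} (ht : 0 < t) (hσ₁ : 0 < σ₁)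
    (hlt : ∀ σ ∈ Ico (0 : ℝ) σ₁, ‖ODE.evolutionMap (fun _ : ℝ => selfSimilarTransport γ 0 V) 0 (-σ) y‖ < t)
    (heq : ‖ODE.evolutionMap (fun _ : ℝ => selfSimilarTransport γ 0 V) 0 (-σ₁) y‖ = t) :
    γ * t ≤ ‖V (ODE.evolutionMap (fun _ : ℝ => selfSimilarTransport γ 0 V) 0 (-σ₁) y)‖ := by
  have h := inner_le_neg_mul_sq_of_firstHit hV hK hσ₁ hlt heq
  set y₁ := ODE.evolutionMap (fun _ : ℝ => selfSimilarTransport γ 0 V) 0 (-σ₁) y with hy₁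
  have hcs : |⟪y₁, V y₁⟫| ≤ ‖y₁‖ * ‖V y₁‖ := abs_real_inner_le_norm y₁ (V y₁)
  rw [heq] at hcs
  have h1 : γ * t ^ 2 ≤ t * ‖V y₁‖ := by
    have := neg_abs_le ⟪y₁, V y₁⟫
    linarith
  have h2 : γ * t * t ≤ ‖V y₁‖ * t := by nlinarith
  exact le_of_mul_le_mul_right h2 ht

/-- **First hitting times exist.**  If `‖y‖ < t ≤ ‖Ψ_L y‖` with `L ≥ 0`, there is a first time `σ₁ ∈ (0, L]` at which the orbit reaches the sphere `‖·‖ = t`: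
`‖Ψ_σ y‖ < t` on `[0, σ₁)` and `‖Ψ_{σ₁} y‖ = t`. [folklore] -/
theorem exists_firstHit_of_exit (hV : ContDiff ℝ 1 V) {K : ℝ} (hK : ∀ y, ‖fderiv ℝ V y‖ ≤ K)
    {y : EuclideanSpace ℝ (Fin 3)} {t L : ℝ} (hL : 0 ≤ L) (hy : ‖y‖ < t)
    (hexit : t ≤ ‖ODE.evolutionMap (fun _ : ℝ => selfSimilarTransport γ 0 V) 0 (-L) y‖) :
    ∃ σ₁ ∈ Ioc (0 : ℝ) L,
      (∀ σ ∈ Ico (0 : ℝ) σ₁, ‖ODE.evolutionMap (fun _ : ℝ => selfSimilarTransport γ 0 V) 0 (-σ) y‖ < t) ∧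
        ‖ODE.evolutionMap (fun _ : ℝ => selfSimilarTransport γ 0 V) 0 (-σ₁) y‖ = t := by
  set f : ℝ → ℝ := fun s => ‖ODE.evolutionMap (fun _ : ℝ => selfSimilarTransport γ 0 V) 0 (-s) y‖ with hf
  have hfc : Continuous f := by
    have hc : Continuous fun s : ℝ => ODE.evolutionMap (fun _ : ℝ => selfSimilarTransport γ 0 V) 0 (-s) y :=
      continuous_iff_continuousAt.2 fun s => (Kelvin.hasDerivAt_flow_neg (γ := γ) hV hK y s).continuousAt
    exact hc.norm
  have hf0 : f 0 = ‖y‖ := by simp [hf, ODE.evolutionMap_self]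
  set S : Set ℝ := Icc 0 L ∩ {s | t ≤ f s} with hS
  have hSc : IsClosed S := isClosed_Icc.inter (isClosed_le continuous_const hfc)
  have hLS : L ∈ S := ⟨⟨hL, le_rfl⟩, hexit⟩
  have hSne : S.Nonempty := ⟨L, hLS⟩
  have hSbdd : BddBelow S := ⟨0, fun s hs => hs.1.1⟩
  set σ₁ := sInf S with hσ₁
  have hσ₁S : σ₁ ∈ S := hSc.csInf_mem hSne hSbdd
  have hσ₁L : σ₁ ≤ L := csInf_le hSbdd hLS
  have hσ₁0 : 0 ≤ σ₁ := hσ₁S.1.1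
  -- below `σ₁` the orbit is strictly inside
  have hbelow : ∀ σ ∈ Ico (0 : ℝ) σ₁, f σ < t := by
    intro σ hσ
    by_contra hge
    have hσS : σ ∈ S := ⟨⟨hσ.1, hσ.2.le.trans hσ₁L⟩, not_lt.1 hge⟩
    exact absurd (csInf_le hSbdd hσS) (not_le.2 hσ.2)
  have hpos : 0 < σ₁ := by
    rcases hσ₁0.eq_or_lt with h | h
    · exfalso
      have := hσ₁S.2
      simp only [mem_setOf_eq, ← h, hf0] at this
      linarith
    · exact h
  -- at `σ₁` the norm is exactly `t`: `≥` from `σ₁ ∈ S`, `≤` by continuity from the left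
  have hle : f σ₁ ≤ t := by
    have htend : Tendsto f (𝓝[<] σ₁) (𝓝 (f σ₁)) := (hfc.tendsto σ₁).mono_left nhdsWithin_le_nhds
    have hev : ∀ᶠ s in 𝓝[<] σ₁, f s ≤ t := by
      filter_upwards [Ioo_mem_nhdsLT hpos] with s hs
      exact (hbelow s ⟨hs.1.le, hs.2⟩).le
    exact le_of_tendsto htend hev
  exact ⟨σ₁, ⟨hpos, hσ₁L⟩, hbelow, le_antisymm hle hσ₁S.2⟩

/-- **EVERY EXIT PRODUCES AN ANOMALOUS POINT ON EVERY INTERMEDIATE SPHERE.**  If a backward similarity orbit goes from `‖y‖ < t` to `‖Ψ_L y‖ ≥ t` (`t > 0`,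
`L ≥ 0`), then at its first hitting point `y₁ = Ψ_{σ₁} y` of the sphere `‖·‖ = t` (`σ₁ ∈ (0, L]`):  `⟪y₁, V y₁⟫ ≤ −γt²` and `γt ≤ ‖V y₁‖`.  (Step (B1) of
THEOREM B, ROUND-42: applied to every `t ∈ [R, 2R]` for an orbit leaving `B(0,2R)` from `B(0,R)`.) [folklore] -/
theorem exists_anomalous_of_exit (hV : ContDiff ℝ 1 V) {K : ℝ} (hK : ∀ y, ‖fderiv ℝ V y‖ ≤ K)
    {y : EuclideanSpace ℝ (Fin 3)} {t L : ℝ} (ht : 0 < t) (hL : 0 ≤ L) (hy : ‖y‖ < t)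
    (hexit : t ≤ ‖ODE.evolutionMap (fun _ : ℝ => selfSimilarTransport γ 0 V) 0 (-L) y‖) :
    ∃ σ₁ ∈ Ioc (0 : ℝ) L,
      ‖ODE.evolutionMap (fun _ : ℝ => selfSimilarTransport γ 0 V) 0 (-σ₁) y‖ = t ∧
      ⟪ODE.evolutionMap (fun _ : ℝ => selfSimilarTransport γ 0 V) 0 (-σ₁) y,
          V (ODE.evolutionMap (fun _ : ℝ => selfSimilarTransport γ 0 V) 0 (-σ₁) y)⟫ ≤ -(γ * t ^ 2) ∧
      γ * t ≤ ‖V (ODE.evolutionMap (fun _ : ℝ => selfSimilarTransport γ 0 V) 0 (-σ₁) y)‖ := by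
  obtain ⟨σ₁, hσ₁, hlt, heq⟩ := exists_firstHit_of_exit hV hK hL hy hexit
  exact ⟨σ₁, hσ₁, heq, inner_le_neg_mul_sq_of_firstHit hV hK hσ₁.1 hlt heq,
    mul_le_norm_of_firstHit hV hK ht hσ₁.1 hlt heq⟩

end Summit.NavierStokesRegularity.NavierStokesRegularity.Theorems.PowerGaugeEulerLiouville.Condenser
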